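import Summits.ResolutionOfSingularities.ResolutionOfSingularities.Theorems.LossEntryW04
import HarnessLib

/-!
# LossEntryW05 — walk plumbing of the loss→entry law `LawLossEntry`, part 5/11

decomp-res-lens-3, gen 29 (HOME/decomp-res-lens-3/g29/NODE-g29.md).  TOOL at 0 toward the residual item
stmt-ResolutionOfSingularities-27367 (`WallCut.NoLossyStrictTailsDeep` ⟸ `LossEpisode.LawLossEntry`).  Imports part 4 (`Theorems.LossEntryW04`, to be landed first).

Contents: §8 the (c)-prepared equation (`coeff_shears_c_of_degree_eq`, `le_snd_of_mem_support_shears_c`, `coeff_shears_c_apex`), §9 the walk after a (c)-loss (`repeat_of_apex`, `pencil_of_loss_c`, `repeat_after_loss_c`, …).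
-/

open MvPolynomial Finset
open Literature.AlgebraicGeometry.Resolution
open Literature.AlgebraicGeometry.Resolution.Hauser2010
open Literature.AlgebraicGeometry.Resolution.PointBlowup
open Summit.ResolutionOfSingularities.ResolutionOfSingularities.Theorems.TightDefectClasses
open Summit.ResolutionOfSingularities.ResolutionOfSingularities.Theorems.TightDefectStrongWalks
open Summit.ResolutionOfSingularities.ResolutionOfSingularities.Theorems.ItineraryCutClasses
open Summit.ResolutionOfSingularities.ResolutionOfSingularities.Theorems.BoundaryLedger
open Summit.ResolutionOfSingularities.ResolutionOfSingularities.Theorems.ProximityCut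
open Summit.ResolutionOfSingularities.ResolutionOfSingularities.Theorems.LossIsFatalLayer (chartMap chartMap_X chartMap_X_self
  chartMap_X_ne chartMap_C)
open Summit.ResolutionOfSingularities.ResolutionOfSingularities.Theorems.LossExitCone
open Summit.ResolutionOfSingularities.ResolutionOfSingularities.Theorems.LossPolygon

/-! ## §8 The (c)-presentation: degree-`o` part of `σ_{i,l,β} σ_{j,l,ν} F`, its ceiling letter `j` and its apex -/

namespace Summit.ResolutionOfSingularities.ResolutionOfSingularities.Theorems.LossPolygon

variable {K : Type} [Field K] [DecidableEq K]
variable {q : ℕ}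

section PencilC

variable {i j l : Fin 3}

omit [DecidableEq K] in
/-- **DEGREE-`o` PART OF THE (c)-PREPARED EQUATION (PROVED):** if every monomial of `F` is `≥ r` (`r l = 0`, `deg r + s = o`),
the degree-`o` part of `F` is `φ₀ u^r (u_l − λ u_j)^s` and `ν λ = 1`, then in degree `o` the equation `σ_{i,l,β} σ_{j,l,ν} F` agrees
with `σ_{i,l,β} σ_{j,l,ν}(φ₀ u^r) · (−λ)^s u_j^s` (the pencil collapses onto the line `u_j = 0` of the chart `l`). [new] -/
theorem coeff_shears_c_of_degree_eq (hij : i ≠ j) (hil : i ≠ l) (hjl : j ≠ l) {s o : ℕ} {r : Fin 3 →₀ ℕ}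
    (hro : r.degree + s = o) (φ₀ : K) {ν lam : K} (hνl : ν * lam = 1) (β : K) {F : MvPolynomial (Fin 3) K}
    (hwall : ∀ D ∈ F.support, r ≤ D)
    (hpen : ∀ E : Fin 3 →₀ ℕ, E.degree = s → coeff (r + E) F = φ₀ * coeff E ((X l - C lam * X j) ^ s))
    {E : Fin 3 →₀ ℕ} (hE : E.degree = o) :
    coeff E (shear i l β (shear j l ν F)) =
      coeff E (shear i l β (shear j l ν (monomial r φ₀)) * monomial (Finsupp.single j s) ((-lam) ^ s)) := by
  classical
  set P : MvPolynomial (Fin 3) K := monomial r φ₀ * (X l - C lam * X j) ^ s with hP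
  have hFP : ∀ D : Fin 3 →₀ ℕ, D.degree = o → coeff D F = coeff D P := by
    intro D hD
    rw [hP, coeff_monomial_mul']
    by_cases hrD : r ≤ D
    · rw [if_pos hrD]
      have hE' : (D - r).degree = s := by
        have h1 : r + (D - r) = D := add_tsub_cancel_of_le hrD
        have h2 := congrArg Finsupp.degree h1
        rw [map_add, hD] at h2
        omega
      rw [← hpen (D - r) hE', add_tsub_cancel_of_le hrD]
    · rw [if_neg hrD]
      by_contra hne
      exact hrD (hwall D (mem_support_iff.mpr hne))
  rw [coeff_shear_congr_degree i l β (fun D hD => coeff_shear_congr_degree j l ν hFP hD) hE]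
  have hC : (C lam : MvPolynomial (Fin 3) K) * C ν = 1 := by rw [← map_mul, mul_comm, hνl, map_one]
  have h2 : shear j l ν (X l - C lam * X j) = C (-lam) * X j := by
    rw [map_sub, map_mul, algHom_C, algebraMap_eq, shear_X j l ν l, if_neg (Ne.symm hjl), shear_X j l ν j, if_pos rfl,
      map_neg]
    linear_combination (-(X l : MvPolynomial (Fin 3) K)) * hC
  have h3 : shear i l β (monomial (Finsupp.single j s) ((-lam) ^ s)) = monomial (Finsupp.single j s) ((-lam) ^ s) := by
    have h0 : (Finsupp.single j s : Fin 3 →₀ ℕ) i = 0 := by rw [Finsupp.single_apply, if_neg (Ne.symm hij)]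
    rw [shear_monomial (Ne.symm hjl) (Ne.symm hil) (Ne.symm hij) β (Finsupp.single j s) ((-lam) ^ s), h0, zero_add,
      Finset.sum_range_one, shearExp_zero (Ne.symm hjl) (Ne.symm hil) (Ne.symm hij), pow_zero, mul_one,
      Nat.choose_zero_right, Nat.cast_one, mul_one]
  have hQ : shear i l β (shear j l ν P) =
      shear i l β (shear j l ν (monomial r φ₀)) * monomial (Finsupp.single j s) ((-lam) ^ s) := by
    rw [hP, map_mul, map_pow, h2, mul_pow, ← C_pow, C_mul_X_pow_eq_monomial, map_mul, h3]
  rw [hQ]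

omit [DecidableEq K] in
/-- **CEILING LETTER OF THE (c)-PRESENTATION (PROVED):** every degree-`o` monomial of `σ_{i,l,β} σ_{j,l,ν} F` has `u_j`-exponent
`≥ s`. [new] -/
theorem le_snd_of_mem_support_shears_c (hij : i ≠ j) (hil : i ≠ l) (hjl : j ≠ l) {s o : ℕ} {r : Fin 3 →₀ ℕ}
    (hro : r.degree + s = o) (φ₀ : K) {ν lam : K} (hνl : ν * lam = 1) (β : K) {F : MvPolynomial (Fin 3) K}
    (hwall : ∀ D ∈ F.support, r ≤ D)
    (hpen : ∀ E : Fin 3 →₀ ℕ, E.degree = s → coeff (r + E) F = φ₀ * coeff E ((X l - C lam * X j) ^ s))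
    {E : Fin 3 →₀ ℕ} (hE : E ∈ (shear i l β (shear j l ν F)).support) (hdeg : E.degree = o) : s ≤ E j := by
  classical
  have h := mem_support_iff.mp hE
  rw [coeff_shears_c_of_degree_eq hij hil hjl hro φ₀ hνl β hwall hpen hdeg, mul_comm, coeff_monomial_mul'] at h
  by_contra hlt
  apply h
  rw [if_neg]
  rw [Finsupp.single_le_iff]
  omega

omit [DecidableEq K] in
/-- **APEX OF THE (c)-PRESENTATION (PROVED):** the coefficient of `u_l^{r i + r j} u_j^s` in `σ_{i,l,β} σ_{j,l,ν} F` is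
`(−λ)^s · φ₀ ν^{r j} β^{r i}` (both walls fully converted into `u_l`). [new] -/
theorem coeff_shears_c_apex (hij : i ≠ j) (hil : i ≠ l) (hjl : j ≠ l) {s o : ℕ} {r : Fin 3 →₀ ℕ} (hrl : r l = 0)
    (hro : r.degree + s = o) (φ₀ : K) {ν lam : K} (hνl : ν * lam = 1) (β : K) {F : MvPolynomial (Fin 3) K}
    (hwall : ∀ D ∈ F.support, r ≤ D)
    (hpen : ∀ E : Fin 3 →₀ ℕ, E.degree = s → coeff (r + E) F = φ₀ * coeff E ((X l - C lam * X j) ^ s)) :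
    coeff (Finsupp.single l (r i + r j) + Finsupp.single j s) (shear i l β (shear j l ν F)) =
      (-lam) ^ s * (φ₀ * ν ^ (r j) * β ^ (r i)) := by
  classical
  have hAdeg : (Finsupp.single l (r i + r j) + Finsupp.single j s : Fin 3 →₀ ℕ).degree = o := by
    rw [map_add, Finsupp.degree_single, Finsupp.degree_single, ← hro, degree_fin3 hij hil hjl r, hrl, add_zero]
  have hle : Finsupp.single j s ≤ Finsupp.single l (r i + r j) + Finsupp.single j s := by
    rw [Finsupp.single_le_iff, Finsupp.add_apply, Finsupp.single_eq_same]; omega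
  rw [coeff_shears_c_of_degree_eq hij hil hjl hro φ₀ hνl β hwall hpen hAdeg, mul_comm, coeff_monomial_mul', if_pos hle,
    add_tsub_cancel_right]
  congr 1
  -- the coefficient of `u_l^{r i + r j}` in `σ_{i,l,β} σ_{j,l,ν} (φ₀ u^r)`: the term `n = r j`, `n' = r i` of the double shear sum
  have hri' : ∀ n, shearExp l i j r n i = r i := fun n => shearExp_apply_snd (Ne.symm hil) hij r n
  rw [shear_monomial (Ne.symm hil) (Ne.symm hjl) hij ν r φ₀, map_sum, coeff_sum, Finset.sum_eq_single (r j)]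
  · rw [shear_monomial (Ne.symm hjl) (Ne.symm hil) (Ne.symm hij) β _ _, coeff_sum, hri', Finset.sum_eq_single (r i)]
    · rw [coeff_monomial, if_pos]
      · rw [Nat.choose_self, Nat.choose_self, Nat.cast_one, mul_one, mul_one]
      · ext w
        rcases fin3_eq_or i j l w hij hil hjl with h | h | h <;> rw [h]
        · rw [shearExp_apply_thd (Ne.symm hil) (Ne.symm hij), hri', Nat.sub_self]
          simp [Ne.symm hil]
        · rw [shearExp_apply_snd (Ne.symm hjl) (Ne.symm hij), shearExp_apply_thd (Ne.symm hjl) hij, Nat.sub_self]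
          simp [Ne.symm hjl]
        · rw [shearExp_apply_fst (Ne.symm hjl) (Ne.symm hil), shearExp_apply_fst (Ne.symm hil) (Ne.symm hjl), hrl, zero_add]
          simp; ring
    · intro n' _ hn'
      rw [coeff_monomial, if_neg]
      intro h
      have h1 := congrArg (fun D : Fin 3 →₀ ℕ => D l) h
      simp only [shearExp_apply_fst (Ne.symm hjl) (Ne.symm hil), shearExp_apply_fst (Ne.symm hil) (Ne.symm hjl), hrl,
        zero_add, Finsupp.single_eq_same] at h1
      omega
    · intro h; exact absurd (Finset.mem_range.mpr (Nat.lt_succ_self _)) h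
  · intro n hn hne
    rw [shear_monomial (Ne.symm hjl) (Ne.symm hil) (Ne.symm hij) β _ _, coeff_sum]
    refine Finset.sum_eq_zero fun n' _ => ?_
    rw [coeff_monomial, if_neg]
    intro h
    have h1 := congrArg (fun D : Fin 3 →₀ ℕ => D j) h
    simp only [shearExp_apply_snd (Ne.symm hjl) (Ne.symm hij), shearExp_apply_thd (Ne.symm hjl) hij,
      Finsupp.single_apply, if_neg (Ne.symm hjl)] at h1
    have hn2 : n ≤ r j := Nat.lt_succ_iff.mp (Finset.mem_range.mp hn)
    omega
  · intro h; exact absurd (Finset.mem_range.mpr (Nat.lt_succ_self _)) h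

end PencilC

end Summit.ResolutionOfSingularities.ResolutionOfSingularities.Theorems.LossPolygon

/-! ## §9 The walk after a (c)-loss: pencil, ceiling, apex, forced repeat, polygon identity, axis witness, and the law -/

namespace Summit.ResolutionOfSingularities.ResolutionOfSingularities.Theorems.LossEpisode

variable {K : Type} [Field K] [DecidableEq K] {q : ℕ} {s₀ : State (Fin 3) K}

section WalkC

variable {W : ForcedWalk q s₀} {N s : ℕ}

/-- **FORCED REPEAT FROM AN APEX (PROVED; the common core of the (b)- and (c)-cases):** after a loss at `t` in the chart `j`
(`ordZero F_t = q + T`, new wall `T e_j`), if `F_{t+1}` contains the apex `u_j^T u_l^s` and its `u_j^T`-layer lies on the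
ceiling `D l ≥ s`, then a proximity repeat at `t + 1` is the UNTRANSLATED `u_i`-chart: the chart `l` and any translation along
`u_l` would put a monomial of degree `T + d < ord F_{t+2}` into `F_{t+2}`. [NODE-g28 F19/F21; new] -/
theorem repeat_of_apex (hroot : IsRoot q s₀) (hT : TailHyp W N s) {t : ℕ} (hNt : N ≤ t) {i j l : Fin 3} (hij : i ≠ j)
    (hli : l ≠ i) (hlj : l ≠ j) (hjt : W.j t = j) (hloss : IsLossMove W t) (hst : StaysOnNewest W t) {T : ℕ}
    (hoT : ordZero (W.st t).F = ((q + T : ℕ) : ℕ∞))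
    (hapex : coeff (Finsupp.single j T + Finsupp.single l s) (W.st (t + 1)).F ≠ 0)
    (hceil : ∀ D ∈ (W.st (t + 1)).F.support, D j = T → s ≤ D l) :
    W.j (t + 1) = i ∧ W.b (t + 1) = 0 := by
  classical
  have hsq : s < q := hT.s_lt
  have h1s : 1 ≤ s := hT.one_le
  obtain ⟨T', hoT', h1T, hr1, hqT, hnext⟩ := lossMove_next hroot hT hNt hloss
  have hTT : T' = T := by
    have h := hoT'.symm.trans hoT
    have h' : q + T' = q + T := by exact_mod_cast h
    omega
  rw [hTT] at h1T hr1 hqT hnext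
  rcases hnext with ⟨hnst, -, -⟩ | ⟨-, l₂, d, hl₂i, hl₂j, hTd, h1d, hS2⟩
  · exact absurd hst hnst
  have hord2 : ordZero (W.st (t + 2)).F = ((s + d + T : ℕ) : ℕ∞) := (runState_ledger hroot hT (by omega) hS2).1
  set A : Fin 3 →₀ ℕ := Finsupp.single j T + Finsupp.single l s with hA
  have hAj : A j = T := by simp [hA, hlj]
  have hAl : A l = s := by simp [hA, Ne.symm hlj]
  have hAi : A i = 0 := by simp [hA, Ne.symm hij, hli]
  have hAdeg : A.degree = T + s := by rw [hA, map_add, Finsupp.degree_single, Finsupp.degree_single]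
  -- a monomial of degree `T + d` cannot occur in `F_{t+2}`
  have hvanish : ∀ D : Fin 3 →₀ ℕ, D.degree = T + d → coeff D (W.st (t + 2)).F = 0 := fun D hD =>
    coeff_eq_zero_of_degree_lt_ordZero (by rw [hord2, hD]; exact_mod_cast (by omega : T + d < s + d + T))
  have hj1 : W.j (t + 1) ≠ j := fun h => hst.1 (h.trans hjt.symm)
  have hbj1 : W.b (t + 1) j = 0 := by have := hst.2; rwa [hjt] at this
  rcases fin3_eq_or i j l (W.j (t + 1)) hij hli.symm (Ne.symm hlj) with hci | hcj | hcl
  · -- chart `i`: the translation along `l` vanishes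
    refine ⟨hci, ?_⟩
    have hbi1 : W.b (t + 1) i = 0 := by rw [← hci]; exact W.onExc (t + 1)
    by_contra hb
    have hμ : W.b (t + 1) l ≠ 0 := by
      intro h0; apply hb; funext w
      rcases fin3_eq_or i j l w hij hli.symm (Ne.symm hlj) with rfl | rfl | rfl
      · exact hbi1
      · exact hbj1
      · exact h0
    have hbw : ∀ w, w ≠ l → W.b (t + 1) w = 0 := fun w hw => by
      rcases fin3_eq_or i j l w hij hli.symm (Ne.symm hlj) with rfl | rfl | rfl
      · exact hbi1
      · exact hbj1
      · exact absurd rfl hw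
    -- the exponent `u_i^s u_j^T` of the sheared equation
    set B : Fin 3 →₀ ℕ := Finsupp.single i s + Finsupp.single j T with hB
    have hBi : B i = s := by simp [hB, Ne.symm hij]
    have hBj : B j = T := by simp [hB, hij]
    have hBl : B l = 0 := by simp [hB, Ne.symm hli, Ne.symm hlj]
    have hBdeg : B.degree = s + T := by rw [hB, map_add, Finsupp.degree_single, Finsupp.degree_single]
    have hPB : ¬ IsPthPowerExponent q B := by
      rw [isPthPowerExponent_iff]; intro h
      have := Nat.le_of_dvd (by omega) (hBi ▸ h i); omega
    have hAB : shearExp i j l A s = B := by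
      ext w
      rcases fin3_eq_or i j l w hij hli.symm (Ne.symm hlj) with rfl | rfl | rfl
      · rw [shearExp_apply_fst hij (Ne.symm hli), hAi, hBi, zero_add]
      · rw [shearExp_apply_snd hij (Ne.symm hlj), hAj, hBj]
      · rw [shearExp_apply_thd (Ne.symm hli) (Ne.symm hlj), hAl, hBl, Nat.sub_self]
    have hcoefB : coeff B (shear l i (W.b (t + 1) l) (W.st (t + 1)).F) =
        coeff A (W.st (t + 1)).F * W.b (t + 1) l ^ s * ((s.choose s : ℕ) : K) := by
      rw [coeff_shear hij (Ne.symm hli) (Ne.symm hlj), Finset.sum_eq_single A]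
      · rw [hAl, Finset.sum_eq_single s]
        · rw [if_pos hAB]
        · intro n hn hns
          rw [if_neg]; intro h
          have := congrArg (fun E => E i) h
          simp only [shearExp_apply_fst hij (Ne.symm hli), hAi, hBi, zero_add] at this
          exact hns this
        · intro h; exact absurd (Finset.mem_range.mpr (Nat.lt_succ_self s)) h
      · intro D hD hDA
        refine Finset.sum_eq_zero fun n hn => ?_
        rw [if_neg]; intro h
        have hn' : n ≤ D l := Nat.lt_succ_iff.mp (Finset.mem_range.mp hn)
        have h_i := congrArg (fun E => E i) h
        have h_j := congrArg (fun E => E j) h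
        have h_l := congrArg (fun E => E l) h
        simp only [shearExp_apply_fst hij (Ne.symm hli), shearExp_apply_snd hij (Ne.symm hlj),
          shearExp_apply_thd (Ne.symm hli) (Ne.symm hlj), hBi, hBj, hBl] at h_i h_j h_l
        have hsl : s ≤ D l := hceil D hD h_j
        apply hDA; ext w
        rcases fin3_eq_or i j l w hij hli.symm (Ne.symm hlj) with rfl | rfl | rfl
        · rw [hAi]; omega
        · rw [hAj]; exact h_j
        · rw [hAl]; omega
      · intro hA'; exact absurd (mem_support_iff.mpr hapex) hA'
    have hBsupp : B ∈ (shear l i (W.b (t + 1) l) (W.st (t + 1)).F).support := by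
      rw [mem_support_iff, hcoefB, Nat.choose_self, Nat.cast_one, mul_one]
      exact mul_ne_zero hapex (pow_ne_zero _ hμ)
    have hmem : chartExponent q i B ∈ (W.st (t + 1 + 1)).F.support := by
      rw [support_succ_shear hroot W (t + 1) hli hci hbw, Finset.mem_image]
      exact ⟨B, Finset.mem_filter.mpr ⟨hBsupp, hPB⟩, rfl⟩
    have hdeg : (chartExponent q i B).degree = T + d := by
      rw [degree_fin3 hij hli.symm (Ne.symm hlj), chartExponent_apply, if_pos rfl, chartExponent_apply, if_neg hij.symm,
        chartExponent_apply, if_neg hli, hBdeg, hBj, hBl]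
      omega
    exact (mem_support_iff.mp hmem) (hvanish _ hdeg)
  · exact absurd hcj hj1
  · -- chart `l`: impossible
    exfalso
    have hbl1 : W.b (t + 1) l = 0 := by rw [← hcl]; exact W.onExc (t + 1)
    have hbw : ∀ w, w ≠ i → W.b (t + 1) w = 0 := fun w hw => by
      rcases fin3_eq_or i j l w hij hli.symm (Ne.symm hlj) with rfl | rfl | rfl
      · exact absurd rfl hw
      · exact hbj1
      · exact hbl1
    have hPA : ¬ IsPthPowerExponent q A := by
      rw [isPthPowerExponent_iff]; intro h
      have := Nat.le_of_dvd (by omega) (hAl ▸ h l); omega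
    have hcoefA : coeff A (shear i l (W.b (t + 1) i) (W.st (t + 1)).F) = coeff A (W.st (t + 1)).F := by
      refine coeff_shear_eq_coeff hlj hli hij.symm (W.b (t + 1) i) _ fun D hD n h1n hnD h => ?_
      have h_j := congrArg (fun E => E j) h
      have h_l := congrArg (fun E => E l) h
      simp only [shearExp_apply_snd hlj hij.symm, shearExp_apply_fst hlj hli, hAj, hAl] at h_j h_l
      have := hceil D hD h_j
      omega
    have hAsupp : A ∈ (shear i l (W.b (t + 1) i) (W.st (t + 1)).F).support := by
      rw [mem_support_iff, hcoefA]; exact hapex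
    have hmem : chartExponent q l A ∈ (W.st (t + 1 + 1)).F.support := by
      rw [support_succ_shear hroot W (t + 1) (Ne.symm hli) hcl hbw, Finset.mem_image]
      exact ⟨A, Finset.mem_filter.mpr ⟨hAsupp, hPA⟩, rfl⟩
    have hdeg : (chartExponent q l A).degree = T + d := by
      rw [degree_fin3 hij hli.symm (Ne.symm hlj), chartExponent_apply, if_neg hli.symm, chartExponent_apply,
        if_neg (Ne.symm hlj), chartExponent_apply, if_pos rfl, hAdeg, hAi, hAj]
      omega
    exact (mem_support_iff.mp hmem) (hvanish _ hdeg)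

/-- **PENCIL DATA AT A (c)-LOSS (PROVED):** at a run state `(i,j,l;k,m)` on the tail whose move is in the chart `l` of the free
letter there are `φ₀ ≠ 0`, `λ ≠ 0` with `b_t(j) · λ = 1` and `coeff (r + E) F_t = φ₀ · coeff E (u_l − λ u_j)^s` (`deg E = s`).
[LossEpisodePencil.runState_pencil, its chart-`l` branch; new] -/
theorem pencil_of_loss_c (hroot : IsRoot q s₀) (hT : TailHyp W N s) {t : ℕ} (hNt : N ≤ t) {i j l : Fin 3} {k m : ℕ}
    (hS : IsRunState W s t i j l k m) (hjt : W.j t = l) :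
    ∃ φ₀ lam : K, φ₀ ≠ 0 ∧ lam ≠ 0 ∧ W.b t j * lam = 1 ∧ ∀ E : Fin 3 →₀ ℕ, E.degree = s →
      coeff ((W.st t).r + E) (W.st t).F = φ₀ * coeff E ((X l - C lam * X j) ^ s) := by
  have hli : l ≠ i := hS.2.1
  have hlj : l ≠ j := hS.2.2.1
  obtain ⟨φ₀, lam, hφ₀, hpen, hcase⟩ := runState_pencil hroot hT hNt hS (fun h => hli (hjt.symm.trans h.1))
  rcases hcase with ⟨hj, -⟩ | ⟨-, hlam, hνl⟩ | ⟨hi, -⟩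
  · exact absurd (hjt.symm.trans hj) hlj
  · exact ⟨φ₀, lam, hφ₀, hlam, hνl, hpen⟩
  · exact absurd (hjt.symm.trans hi) hli

/-- Degree bound for the (c)-prepared equation `σ_{i,l,g} σ_{j,l,g'} F_u` of a run state. [folklore] -/
theorem le_degree_of_mem_support_prepared_c (hroot : IsRoot q s₀) (hT : TailHyp W N s) {u : ℕ} (hNu : N ≤ u) {i j l : Fin 3}
    {k m : ℕ} (hS : IsRunState W s u i j l k m) (g g' : K) {E : Fin 3 →₀ ℕ}
    (hE : E ∈ (shear i l g (shear j l g' (W.st u).F)).support) : k + m + s ≤ E.degree :=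
  le_degree_of_mem_support_shear hS.2.2.1 hS.2.1 hS.1.symm g
    (fun _ hE' => le_degree_of_mem_support_shear hS.2.1 hS.2.2.1 hS.1 g'
      (fun _ hD' => le_degree_of_mem_support_runState hroot hT hNu hS hD') hE') hE

/-- **THE `u_l^T`-LAYER AFTER A (c)-LOSS LIES ON THE CEILING `D j ≥ s` (PROVED).** [new] -/
theorem le_snd_of_mem_support_succ_loss_c (hroot : IsRoot q s₀) (hT : TailHyp W N s) {t : ℕ} (hNt : N ≤ t) {i j l : Fin 3}
    {k m : ℕ} (hS : IsRunState W s t i j l k m) (hjt : W.j t = l) {D : Fin 3 →₀ ℕ} (hD : D ∈ (W.st (t + 1)).F.support)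
    (hDl : D l = k + m + s - q) : s ≤ D j := by
  classical
  have hq := (runState_ledger hroot hT hNt hS).2.1
  have hij : i ≠ j := hS.1
  have hli : l ≠ i := hS.2.1
  have hlj : l ≠ j := hS.2.2.1
  obtain ⟨φ₀, lam, -, -, hνl, hpen⟩ := pencil_of_loss_c hroot hT hNt hS hjt
  have hro : (W.st t).r.degree + s = k + m + s := by
    rw [hS.2.2.2.2.2.1, map_add, Finsupp.degree_single, Finsupp.degree_single]
  rw [support_succ_two_shears hroot W t hli.symm (Ne.symm hlj) hij hjt, Finset.mem_image] at hD
  obtain ⟨E, hE, hED⟩ := hD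
  have hEsupp := (Finset.mem_filter.mp hE).1
  have hoE : k + m + s ≤ E.degree := le_degree_of_mem_support_prepared_c hroot hT hNt hS _ _ hEsupp
  have h1 : D l = E.degree - q := by rw [← hED, chartExponent_apply, if_pos rfl]
  have hEdeg : E.degree = k + m + s := by omega
  have hEj : s ≤ E j :=
    le_snd_of_mem_support_shears_c hij hli.symm (Ne.symm hlj) hro φ₀ hνl (W.b t i) (walk_r hroot W t) hpen hEsupp hEdeg
  rw [← hED, chartExponent_apply, if_neg (Ne.symm hlj)]
  exact hEj

/-- **THE APEX `u_l^T u_j^s` OF `F_{t+1}` AFTER A (c)-LOSS (PROVED):** its coefficient is `(−λ)^s φ₀ ν^m β^k ≠ 0`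
(`β = b_t(i) ≠ 0`, `ν = b_t(j) ≠ 0`). [new] -/
theorem coeff_succ_loss_c_apex_ne_zero (hroot : IsRoot q s₀) (hT : TailHyp W N s) {t : ℕ} (hNt : N ≤ t) {i j l : Fin 3}
    {k m : ℕ} (hS : IsRunState W s t i j l k m) (hjt : W.j t = l) (hbi : W.b t i ≠ 0) (hbj : W.b t j ≠ 0) :
    coeff (Finsupp.single l (k + m + s - q) + Finsupp.single j s) (W.st (t + 1)).F ≠ 0 := by
  classical
  have hq := (runState_ledger hroot hT hNt hS).2.1
  obtain ⟨hri, hrj, hrl⟩ := hS.r_apply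
  have hij : i ≠ j := hS.1
  have hli : l ≠ i := hS.2.1
  have hlj : l ≠ j := hS.2.2.1
  have hsq : s < q := hT.s_lt
  have h1s : 1 ≤ s := hT.one_le
  obtain ⟨φ₀, lam, hφ₀, hlam, hνl, hpen⟩ := pencil_of_loss_c hroot hT hNt hS hjt
  have hro : (W.st t).r.degree + s = k + m + s := by
    rw [hS.2.2.2.2.2.1, map_add, Finsupp.degree_single, Finsupp.degree_single]
  set E : Fin 3 →₀ ℕ := Finsupp.single l (k + m) + Finsupp.single j s with hEdef
  have hEdeg : E.degree = k + m + s := by rw [hEdef, map_add, Finsupp.degree_single, Finsupp.degree_single]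
  have hqE : q ≤ E.degree := by rw [hEdeg]; omega
  have hEi : E i = 0 := by simp [hEdef, hli, Ne.symm hij]
  have hEl : E l = k + m := by simp [hEdef, Ne.symm hlj]
  have hEj : E j = s := by simp [hEdef, hlj]
  have hPE : ¬ IsPthPowerExponent q E := by
    rw [isPthPowerExponent_iff]
    intro h
    have := Nat.le_of_dvd (by omega) (hEj ▸ h j)
    omega
  have hcE : chartExponent q l E = Finsupp.single l (k + m + s - q) + Finsupp.single j s := by
    ext w
    rw [chartExponent_apply]
    rcases fin3_eq_or i j l w hij hli.symm (Ne.symm hlj) with h | h | h <;> rw [h]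
    · rw [if_neg (Ne.symm hli), hEi]; simp [hli, Ne.symm hij]
    · rw [if_neg (Ne.symm hlj), hEj]; simp [hlj]
    · rw [if_pos rfl, hEdeg]; simp [Ne.symm hlj]
  rw [← hcE, coeff_succ_two_shears hroot W t hli.symm (Ne.symm hlj) hij hjt hqE hPE]
  have hE' : E = Finsupp.single l ((W.st t).r i + (W.st t).r j) + Finsupp.single j s := by rw [hri, hrj]
  rw [hE', coeff_shears_c_apex hij hli.symm (Ne.symm hlj) hrl hro φ₀ hνl (W.b t i) (walk_r hroot W t) hpen, hri, hrj]
  exact mul_ne_zero (pow_ne_zero _ (neg_ne_zero.mpr hlam))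
    (mul_ne_zero (mul_ne_zero hφ₀ (pow_ne_zero _ hbj)) (pow_ne_zero _ hbi))

/-- **THE REPEAT AFTER A (c)-LOSS IS THE UNTRANSLATED `u_i`-CHART (PROVED).** [new] -/
theorem repeat_after_loss_c (hroot : IsRoot q s₀) (hT : TailHyp W N s) {t : ℕ} (hNt : N ≤ t) {i j l : Fin 3} {k m : ℕ}
    (hS : IsRunState W s t i j l k m) (hjt : W.j t = l) (hbi : W.b t i ≠ 0) (hbj : W.b t j ≠ 0) (hloss : IsLossMove W t)
    (hst : StaysOnNewest W t) : W.j (t + 1) = i ∧ W.b (t + 1) = 0 := by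
  obtain ⟨hord, hq, -, -, -⟩ := runState_ledger hroot hT hNt hS
  have hoT : ordZero (W.st t).F = ((q + (k + m + s - q) : ℕ) : ℕ∞) := by
    rw [hord]; congr 1; omega
  exact repeat_of_apex hroot hT hNt hS.2.1.symm hS.1.symm (Ne.symm hS.2.2.1) hjt hloss hst hoT
    (coeff_succ_loss_c_apex_ne_zero hroot hT hNt hS hjt hbi hbj)
    (fun D hD hDl => le_snd_of_mem_support_succ_loss_c hroot hT hNt hS hjt hD hDl)

end WalkC

end Summit.ResolutionOfSingularities.ResolutionOfSingularities.Theorems.LossEpisode
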